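import Summits.AtomisticToContinuum.FouriersLaw.Theorems.HonestZwanzigFeshbachIdentitiesContinuity
import Summits.AtomisticToContinuum.FouriersLaw.Theorems.HonestZwanzigFeshbachIdentitiesResolventA

/-!
# `HonestZwanzig.FeshbachIdentities`, part 6: the resolvent inequality and the injectivity of the resolvent

Support file for item `stmt-AtomisticToContinuum-12697` (`HonestZwanzig.FeshbachIdentities`), clause (iv-b).
Pinned anharmonic chain `P = pinnedChain ω₂ lam β γ` (`ω₂ > 0`, `lam ≥ 0`, `β, γ > 0`), `N ≥ 1`, `T > 0`,
`μ_T = gibbsMeasure N T`, `P_t = transitionKernel N T T t`, a nice observable `v` (`|v| ≤ C e^{ϑH}`, `0 < ϑ`,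
`2ϑ < 1/T`), `s > 0`, and the resolvent `R_s v(z) = ∫_{(0,∞)} e^{-st} P_t v(z) dt` (written out):

* `pinnedChain_integral_mul_resolvent_ge` — **`s ‖R_s v‖²_{L²(μ_T)} ≤ ⟨v, R_s v⟩_{μ_T}`**: from the shift identity
  `R_s v - e^{-sh} P_h R_s v = ∫₀ʰ e^{-st} P_t v dt` (part 5), Fubini, the `L²(μ_T)`-contraction of `P_h` and the time
  continuity of `t ↦ ⟨R_s v, P_t v⟩` (part 4), comparing derivatives at `h = 0` — the semigroup form of
  `Re⟨(s - L)w, w⟩ ≥ s‖w‖²` for a contraction semigroup, with no generator theory;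
* `pinnedChain_integral_sq_eq_zero_of_resolvent` — **injectivity**: `‖R_s v‖_{L²(μ_T)} = 0 ⇒ ‖v‖_{L²(μ_T)} = 0`.
-/

noncomputable section

open MeasureTheory ProbabilityTheory Filter Topology Set Function
open scoped NNReal ENNReal
open Literature.MathematicalPhysics.KineticTheory.HeatConduction
open Literature.MathematicalPhysics.KineticTheory Literature.Probability.Process OscillatorChain
open Summit.AtomisticToContinuum.FouriersLaw.Theorems.SubdiffusiveBondHeat
open Summit.AtomisticToContinuum.FouriersLaw.Theorems.OddSectorIrreversibility
open Summit.AtomisticToContinuum.FouriersLaw.Theorems.ExtensiveSnapshotIrreversibility.ClausiusBudget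

namespace Summit.AtomisticToContinuum.FouriersLaw.Theorems.HonestZwanzig

variable {N : ℕ}

section PinnedB

variable {ω₂ lam β γ : ℝ} (hω : 0 < ω₂) (hl : 0 ≤ lam) (hβ : 0 < β) (hγ : 0 < γ) (hN : 0 < N)
  {T : ℝ} (hT : 0 < T)
include hω hl hβ hγ hN hT

/-! ### Elementary facts on the resolvent -/

omit hN hT in
/-- `P_0 v = v`. [folklore] -/
theorem pinnedChain_act_zero (v : PhaseSpace N → ℝ) (z : PhaseSpace N) :
    ∫ y, v y ∂((pinnedChain ω₂ lam β γ).transitionKernel N T T (0 : ℝ).toNNReal z) = v z := by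
  rw [Real.toNNReal_zero, pinnedChain_transitionKernel_zero hω hl hβ.le hγ.le N T T, Kernel.id_apply, integral_dirac]

/-- The resolvent of a nice observable is dominated by `(B/s) e^{ϑH}` and square integrable, and so is its image
under every `P_h`: `∫ (P_h R_s v)² dμ_T ≤ ∫ (R_s v)² dμ_T`. [folklore] -/
theorem pinnedChain_resolvent_sq_facts {ϑ : ℝ} (hϑ0 : 0 < ϑ) (h2ϑ : 2 * ϑ < 1 / T)
    {v : PhaseSpace N → ℝ} (hv : Continuous v) {Cv : ℝ} (hCv : 0 ≤ Cv)
    (hvb : ∀ y, |v y| ≤ Cv * Real.exp (ϑ * (pinnedChain ω₂ lam β γ).hamiltonian N y)) {s : ℝ} (hs : 0 < s) :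
    ∃ D : ℝ, 0 ≤ D ∧
      (StronglyMeasurable fun z : PhaseSpace N => ∫ t in Ioi (0 : ℝ), Real.exp (-(s * t)) *
        ∫ y, v y ∂((pinnedChain ω₂ lam β γ).transitionKernel N T T t.toNNReal z)) ∧
      (∀ z, |∫ t in Ioi (0 : ℝ), Real.exp (-(s * t)) *
          ∫ y, v y ∂((pinnedChain ω₂ lam β γ).transitionKernel N T T t.toNNReal z)| ≤
        D * Real.exp (ϑ * (pinnedChain ω₂ lam β γ).hamiltonian N z)) ∧
      Integrable (fun z => (∫ t in Ioi (0 : ℝ), Real.exp (-(s * t)) *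
          ∫ y, v y ∂((pinnedChain ω₂ lam β γ).transitionKernel N T T t.toNNReal z)) ^ 2)
        ((pinnedChain ω₂ lam β γ).gibbsMeasure N T) ∧
      ∀ h : ℝ≥0,
        Integrable (fun z => (∫ y', (∫ t in Ioi (0 : ℝ), Real.exp (-(s * t)) *
            ∫ y, v y ∂((pinnedChain ω₂ lam β γ).transitionKernel N T T t.toNNReal y'))
            ∂((pinnedChain ω₂ lam β γ).transitionKernel N T T h z)) ^ 2) ((pinnedChain ω₂ lam β γ).gibbsMeasure N T) ∧
        ∫ z, (∫ y', (∫ t in Ioi (0 : ℝ), Real.exp (-(s * t)) *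
            ∫ y, v y ∂((pinnedChain ω₂ lam β γ).transitionKernel N T T t.toNNReal y'))
            ∂((pinnedChain ω₂ lam β γ).transitionKernel N T T h z)) ^ 2 ∂((pinnedChain ω₂ lam β γ).gibbsMeasure N T) ≤
          ∫ z, (∫ t in Ioi (0 : ℝ), Real.exp (-(s * t)) *
            ∫ y, v y ∂((pinnedChain ω₂ lam β γ).transitionKernel N T T t.toNNReal z)) ^ 2
            ∂((pinnedChain ω₂ lam β γ).gibbsMeasure N T) := by
  have hϑ1 : ϑ < 1 / T := by linarith
  obtain ⟨K, c, -, hc, hb⟩ := pinnedChain_harris_bound hω hl hβ hγ hN hT hϑ0 hϑ1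
  set P := pinnedChain ω₂ lam β γ with hP
  set B : ℝ := |∫ y, v y ∂(P.gibbsMeasure N T)| + K * Cv with hB
  have hWm := pinnedChain_stronglyMeasurable_resolvent hω hl hβ.le hγ.le T T (N := N) hv.measurable s
  have hWb : ∀ z, |∫ t in Ioi (0 : ℝ), Real.exp (-(s * t)) * ∫ y, v y ∂(P.transitionKernel N T T t.toNNReal z)| ≤
      B / s * Real.exp (ϑ * P.hamiltonian N z) := fun z => by
    have := pinnedChain_abs_resolvent_le hω hl hβ hϑ0 hb hc hv hCv hvb hs z
    rwa [div_mul_eq_mul_div]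
  have hB0 : 0 ≤ B := by
    have hK : 0 ≤ K * Cv := by
      have h1 := hb 0 0 (fun _ => (0:ℝ)) continuous_const 0 le_rfl (fun y => by simp)
      have h2 := hb 0 0 v hv Cv hCv hvb
      have : 0 ≤ K * Cv * Real.exp (ϑ * P.hamiltonian N 0) * Real.exp (-c * ((0 : ℝ≥0) : ℝ)) :=
        (abs_nonneg _).trans h2
      have hpos : 0 < Real.exp (ϑ * P.hamiltonian N 0) * Real.exp (-c * ((0 : ℝ≥0) : ℝ)) := by positivity
      nlinarith
    positivity
  refine ⟨B / s, by positivity, hWm, hWb, ?_, fun h => ?_⟩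
  · exact (pinnedChain_integral_sq_act_le_of_stronglyMeasurable hω hl hβ hγ hN hT hϑ0 h2ϑ hWm hWb 0).1
  · have h3 := pinnedChain_integral_sq_act_le_of_stronglyMeasurable hω hl hβ hγ hN hT hϑ0 h2ϑ hWm hWb h
    exact ⟨h3.2.1, h3.2.2⟩

/-! ### The resolvent inequality `⟨v, R_s v⟩ ≥ s ‖R_s v‖²` -/

/-- **The resolvent inequality.** For a nice observable `v` (`0 < ϑ`, `2ϑ < 1/T`) and `s > 0`, with
`R_s v(z) = ∫_{(0,∞)} e^{-st} P_t v(z) dt`:  `s ∫ (R_s v)² dμ_T ≤ ∫ v · R_s v dμ_T`.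
Proof: by the shift identity `R_s v - e^{-sh} P_h R_s v = ∫₀ʰ e^{-st} P_t v dt`, Fubini, and the `L²(μ_T)`-contraction
`⟨R_s v, P_h R_s v⟩ ≤ ‖R_s v‖²`, one gets `∫₀ʰ e^{-st} ⟨R_s v, P_t v⟩ dt ≥ (1 - e^{-sh}) ‖R_s v‖²` for every `h > 0`;
`t ↦ ⟨R_s v, P_t v⟩` is continuous with value `⟨R_s v, v⟩` at `0`, and comparing derivatives at `h = 0` gives the
claim. This is the semigroup version of `Re ⟨(s - L) w, w⟩ ≥ s‖w‖²` for the generator of a contraction semigroup.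
[cite: CuneoEckmannHairerReyBellet2018, Thm 2.13] -/
theorem pinnedChain_integral_mul_resolvent_ge {ϑ : ℝ} (hϑ0 : 0 < ϑ) (h2ϑ : 2 * ϑ < 1 / T)
    {v : PhaseSpace N → ℝ} (hv : Continuous v) {Cv : ℝ} (hCv : 0 ≤ Cv)
    (hvb : ∀ y, |v y| ≤ Cv * Real.exp (ϑ * (pinnedChain ω₂ lam β γ).hamiltonian N y)) {s : ℝ} (hs : 0 < s) :
    s * ∫ z, (∫ t in Ioi (0 : ℝ), Real.exp (-(s * t)) *
        ∫ y, v y ∂((pinnedChain ω₂ lam β γ).transitionKernel N T T t.toNNReal z)) ^ 2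
        ∂((pinnedChain ω₂ lam β γ).gibbsMeasure N T) ≤
      ∫ z, v z * (∫ t in Ioi (0 : ℝ), Real.exp (-(s * t)) *
        ∫ y, v y ∂((pinnedChain ω₂ lam β γ).transitionKernel N T T t.toNNReal z))
        ∂((pinnedChain ω₂ lam β γ).gibbsMeasure N T) := by
  have hϑ1 : ϑ < 1 / T := by linarith
  set P := pinnedChain ω₂ lam β γ with hP
  set μ := P.gibbsMeasure N T with hμ
  set κ := P.transitionKernel N T T with hκ
  haveI : IsProbabilityMeasure μ := pinnedChain_isProbabilityMeasure_gibbsMeasure hω hl hβ.le γ N hT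
  obtain ⟨K, c, -, hc, hb⟩ := pinnedChain_harris_bound hω hl hβ hγ hN hT hϑ0 hϑ1
  set act : ℝ → PhaseSpace N → ℝ := fun t z => ∫ y, v y ∂(κ t.toNNReal z) with hact
  set W : PhaseSpace N → ℝ := fun z => ∫ t in Ioi (0 : ℝ), Real.exp (-(s * t)) * act t z with hW
  obtain ⟨D, hD0, hWm, hWb, hW2, hPW⟩ := pinnedChain_resolvent_sq_facts hω hl hβ hγ hN hT hϑ0 h2ϑ hv hCv hvb hs
  set A : ℝ := ∫ z, W z ^ 2 ∂μ with hA
  -- the continuous function `φ(t) = ⟨W, P_t v⟩`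
  set φ : ℝ → ℝ := fun t => ∫ z, W z * act t z ∂μ with hφ
  have hφc : Continuous φ := pinnedChain_continuous_corr_of_sq_integrable hω hl hβ hγ hN hT hϑ0 h2ϑ hWm hW2 hv hvb
  have hφ0 : φ 0 = ∫ z, v z * W z ∂μ := by
    simp only [hφ]
    refine integral_congr_ae (Eventually.of_forall fun z => ?_)
    show W z * act 0 z = v z * W z
    have hz : act 0 z = v z := pinnedChain_act_zero hω hl hβ hγ v z
    rw [hz, mul_comm]
  -- the key inequality for `h > 0`
  have hE2 : Integrable (fun y => Real.exp (2 * ϑ * P.hamiltonian N y)) μ :=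
    pinnedChain_integrable_exp_mul_hamiltonian_gibbsMeasure hω hl hβ.le γ N hT h2ϑ
  have hkey : ∀ h : ℝ, 0 < h → (1 - Real.exp (-(s * h))) * A ≤ ∫ t in (0 : ℝ)..h, Real.exp (-(s * t)) * φ t := by
    intro h hh
    set hh' : ℝ≥0 := ⟨h, hh.le⟩
    -- Fubini: `∫ W V_h dμ = ∫₀ʰ e^{-st} φ`
    have hexp : IntegrableOn (fun t : ℝ => Real.exp (-(s * t))) (Ioc 0 h) :=
      (Real.continuous_exp.comp (continuous_const.mul continuous_id).neg).integrableOn_Icc.mono_set Ioc_subset_Icc_self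
    have hF := pinnedChain_integral_mul_setIntegral_exp_act hω hl hβ hγ hϑ0 hb hc hv hCv hvb μ hE2 hWm hW2 hexp
    rw [intervalIntegral.integral_of_le hh.le, ← hF]
    -- the shift identity: `∫_{Ioc} e^{-st} act t z = W z - e^{-sh} P_h W z`
    have hV : ∀ z, ∫ t in Ioc 0 h, Real.exp (-(s * t)) * act t z = W z - Real.exp (-(s * h)) * ∫ y, W y ∂(κ hh' z) := by
      intro z
      have hsh := pinnedChain_act_resolvent_eq hω hl hβ hγ hN hT hϑ0 h2ϑ hv hCv hvb hs hh' z
      have hcoe : ((hh' : ℝ≥0) : ℝ) = h := rfl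
      simp only [hcoe] at hsh
      rw [← intervalIntegral.integral_of_le hh.le]
      show ∫ t in (0 : ℝ)..h, Real.exp (-(s * t)) * act t z = W z - Real.exp (-(s * h)) * ∫ y, W y ∂(κ hh' z)
      rw [hsh, ← mul_assoc, ← Real.exp_add, show -(s * h) + s * h = 0 by ring, Real.exp_zero, one_mul]
      ring
    have hVeq : (fun z => W z * ∫ t in Ioc 0 h, Real.exp (-(s * t)) * act t z) =
        fun z => W z ^ 2 - Real.exp (-(s * h)) * (W z * ∫ y, W y ∂(κ hh' z)) := by
      funext z; rw [hV z]; ring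
    rw [hVeq]
    -- integrability and the contraction bound on `⟨W, P_h W⟩`
    obtain ⟨hPW2, hPWle⟩ := hPW hh'
    have hWPm : AEStronglyMeasurable (fun z => ∫ y, W y ∂(κ hh' z)) μ :=
      (hWm.integral_kernel (κ := κ hh')).aestronglyMeasurable
    have hI : Integrable (fun z => W z * ∫ y, W y ∂(κ hh' z)) μ := by
      have hI' : Integrable (fun z => (W z ^ 2 + (∫ y, W y ∂(κ hh' z)) ^ 2) / 2) μ := (hW2.add hPW2).div_const 2
      refine hI'.mono' (hWm.aestronglyMeasurable.mul hWPm) (Eventually.of_forall fun z => ?_)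
      rw [Real.norm_eq_abs, abs_mul]
      nlinarith [sq_nonneg (|W z| - |∫ y, W y ∂(κ hh' z)|), sq_abs (W z), sq_abs (∫ y, W y ∂(κ hh' z))]
    have hCS : ∫ z, W z * ∫ y, W y ∂(κ hh' z) ∂μ ≤ A := by
      have h1 : ∫ z, W z * ∫ y, W y ∂(κ hh' z) ∂μ ≤ ∫ z, (W z ^ 2 + (∫ y, W y ∂(κ hh' z)) ^ 2) / 2 ∂μ := by
        refine integral_mono hI ((hW2.add hPW2).div_const 2) fun z => ?_
        dsimp only
        nlinarith [sq_nonneg (W z - ∫ y, W y ∂(κ hh' z))]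
      rw [integral_div, integral_add hW2 hPW2] at h1
      rw [hA]
      linarith
    rw [integral_sub hW2 (hI.const_mul _), integral_const_mul]
    have hepos : 0 < Real.exp (-(s * h)) := Real.exp_pos _
    nlinarith
  -- compare derivatives at `h = 0`
  set I : ℝ → ℝ := fun h => ∫ t in (0 : ℝ)..h, Real.exp (-(s * t)) * φ t with hI
  set J : ℝ → ℝ := fun h => (1 - Real.exp (-(s * h))) * A with hJ
  have hgc : Continuous fun t => Real.exp (-(s * t)) * φ t :=
    (Real.continuous_exp.comp (continuous_const.mul continuous_id).neg).mul hφc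
  have hIder : HasDerivAt I (Real.exp (-(s * 0)) * φ 0) 0 :=
    intervalIntegral.integral_hasDerivAt_right (hgc.intervalIntegrable 0 0) (hgc.stronglyMeasurableAtFilter _ _)
      hgc.continuousAt
  have hJder : HasDerivAt J (s * A) 0 := by
    have h1 : HasDerivAt (fun h : ℝ => Real.exp (-(s * h))) (Real.exp (-(s * 0)) * (-s)) 0 := by
      have := ((hasDerivAt_id (0:ℝ)).const_mul s).neg.exp
      simpa using this
    have h2 := (h1.const_sub 1).mul_const A
    refine h2.congr_deriv ?_
    simp
  have hI0 : I 0 = 0 := by simp [hI]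
  have hJ0 : J 0 = 0 := by simp [hJ]
  have hlimI := hIder.tendsto_slope_zero_right
  have hlimJ := hJder.tendsto_slope_zero_right
  simp only [zero_add, hI0, hJ0, sub_zero, mul_zero, neg_zero, Real.exp_zero, one_mul, smul_eq_mul] at hlimI hlimJ
  have hle : ∀ᶠ h in 𝓝[>] (0 : ℝ), h⁻¹ * J h ≤ h⁻¹ * I h := by
    refine eventually_nhdsWithin_of_forall fun h hh => ?_
    exact mul_le_mul_of_nonneg_left (hkey h hh) (inv_nonneg.2 (le_of_lt hh))
  have := le_of_tendsto_of_tendsto hlimJ hlimI hle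
  rw [hφ0] at this
  simpa [hA, hW, hact] using this

/-! ### Injectivity of the resolvent on nice observables -/

/-- **Injectivity of `R_s`**: for a nice `v` and `s > 0`, if `∫ (R_s v)² dμ_T = 0` then `∫ v² dμ_T = 0`. Indeed
`R_s v = 0` a.e. forces `P_h R_s v = 0` a.e. (invariance), so `∫₀ʰ e^{-st} P_t v dt = 0` a.e. by the shift identity,
whence `∫₀ʰ e^{-st} ⟨v, P_t v⟩ dt = 0` for all `h > 0`; the continuous integrand vanishes, and at `t = 0` it is
`⟨v, v⟩`. [folklore] -/
theorem pinnedChain_integral_sq_eq_zero_of_resolvent {ϑ : ℝ} (hϑ0 : 0 < ϑ) (h2ϑ : 2 * ϑ < 1 / T)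
    {v : PhaseSpace N → ℝ} (hv : Continuous v) {Cv : ℝ} (hCv : 0 ≤ Cv)
    (hvb : ∀ y, |v y| ≤ Cv * Real.exp (ϑ * (pinnedChain ω₂ lam β γ).hamiltonian N y)) {s : ℝ} (hs : 0 < s)
    (h0 : ∫ z, (∫ t in Ioi (0 : ℝ), Real.exp (-(s * t)) *
        ∫ y, v y ∂((pinnedChain ω₂ lam β γ).transitionKernel N T T t.toNNReal z)) ^ 2
        ∂((pinnedChain ω₂ lam β γ).gibbsMeasure N T) = 0) :
    ∫ z, v z ^ 2 ∂((pinnedChain ω₂ lam β γ).gibbsMeasure N T) = 0 := by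
  have hϑ1 : ϑ < 1 / T := by linarith
  set P := pinnedChain ω₂ lam β γ with hP
  set μ := P.gibbsMeasure N T with hμ
  set κ := P.transitionKernel N T T with hκ
  haveI : IsProbabilityMeasure μ := pinnedChain_isProbabilityMeasure_gibbsMeasure hω hl hβ.le γ N hT
  haveI : ∀ u, IsMarkovKernel (κ u) := fun u => pinnedChain_isMarkovKernel_transitionKernel hω hl hβ.le hγ.le N T T u
  obtain ⟨K, c, -, hc, hb⟩ := pinnedChain_harris_bound hω hl hβ hγ hN hT hϑ0 hϑ1
  set act : ℝ → PhaseSpace N → ℝ := fun t z => ∫ y, v y ∂(κ t.toNNReal z) with hact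
  set W : PhaseSpace N → ℝ := fun z => ∫ t in Ioi (0 : ℝ), Real.exp (-(s * t)) * act t z with hW
  obtain ⟨D, hD0, hWm, hWb, hW2, -⟩ := pinnedChain_resolvent_sq_facts hω hl hβ hγ hN hT hϑ0 h2ϑ hv hCv hvb hs
  -- `W = 0` a.e., hence `P_h W = 0` a.e.
  have hW0 : W =ᵐ[μ] 0 := by
    have h1 : (fun z => W z ^ 2) =ᵐ[μ] 0 := (integral_eq_zero_iff_of_nonneg (fun z => sq_nonneg _) hW2).1 h0
    filter_upwards [h1] with z hz
    simpa using hz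
  have hWi : Integrable W μ :=
    integrable_of_abs_le_exp_of_stronglyMeasurable
      (pinnedChain_integrable_exp_mul_hamiltonian_gibbsMeasure hω hl hβ.le γ N hT hϑ1) hWm hWb
  have hPW0 : ∀ h : ℝ≥0, (fun z => ∫ y, W y ∂(κ h z)) =ᵐ[μ] 0 := by
    intro h
    have habs : ∫ z, |∫ y, W y ∂(κ h z)| ∂μ ≤ 0 := by
      have h1 : ∫ z, |∫ y, W y ∂(κ h z)| ∂μ ≤ ∫ z, (∫ y, |W y| ∂(κ h z)) ∂μ := by
        refine integral_mono_of_nonneg (Eventually.of_forall fun z => abs_nonneg _) ?_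
          (Eventually.of_forall fun z => abs_integral_le_integral_abs)
        have hinv := pinnedChain_gibbsMeasure_bind_transitionKernel hω hl hβ.le hγ.le hN hT h
        have h' : (κ h ∘ₖ Kernel.const Unit μ) () = μ := by rw [← Measure.comp_eq_comp_const_apply]; exact hinv
        have hWa : Integrable (fun y => |W y|) ((κ h ∘ₖ Kernel.const Unit μ) ()) := by rw [h']; exact hWi.abs
        have := hWa.integral_comp
        rwa [Kernel.const_apply] at this
      have h2 : ∫ z, (∫ y, |W y| ∂(κ h z)) ∂μ = ∫ z, |W z| ∂μ :=
        pinnedChain_integral_transitionKernel_gibbsMeasure hω hl hβ.le hγ.le hN hT h hWi.abs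
      have h3 : ∫ z, |W z| ∂μ = 0 := by
        rw [integral_congr_ae (hW0.mono fun z hz => show |W z| = 0 by rw [hz]; simp), integral_zero]
      linarith
    have hmeas : AEStronglyMeasurable (fun z => ∫ y, W y ∂(κ h z)) μ :=
      (hWm.integral_kernel (κ := κ h)).aestronglyMeasurable
    have hint : Integrable (fun z => |∫ y, W y ∂(κ h z)|) μ := by
      refine ⟨hmeas.norm.congr (Eventually.of_forall fun z => by simp [Real.norm_eq_abs]), ?_⟩
      have : HasFiniteIntegral (fun z => |∫ y, W y ∂(κ h z)|) μ ↔
          HasFiniteIntegral (fun z => ∫ y, W y ∂(κ h z)) μ := by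
        simp only [HasFiniteIntegral, Real.enorm_eq_ofReal_abs, abs_abs]
      rw [this]
      -- finite integral from the weighted bound `|P_h W| ≤ P_h |W|`, whose integral is finite
      have hinv := pinnedChain_gibbsMeasure_bind_transitionKernel hω hl hβ.le hγ.le hN hT h
      have h' : (κ h ∘ₖ Kernel.const Unit μ) () = μ := by rw [← Measure.comp_eq_comp_const_apply]; exact hinv
      have hWa : Integrable W ((κ h ∘ₖ Kernel.const Unit μ) ()) := by rw [h']; exact hWi
      have := hWa.integral_comp
      rw [Kernel.const_apply] at this
      exact this.hasFiniteIntegral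
    have h4 := (integral_eq_zero_iff_of_nonneg (fun z => abs_nonneg _) hint).1 (le_antisymm habs
      (integral_nonneg fun z => abs_nonneg _))
    filter_upwards [h4] with z hz
    simpa using hz
  -- hence `∫₀ʰ e^{-st} P_t v(z) dt = 0` for a.e. `z`, for every `h > 0`
  have hV0 : ∀ h : ℝ, 0 < h → (fun z => ∫ t in Ioc 0 h, Real.exp (-(s * t)) * act t z) =ᵐ[μ] 0 := by
    intro h hh
    set hh' : ℝ≥0 := ⟨h, hh.le⟩
    filter_upwards [hW0, hPW0 hh'] with z hz1 hz2
    have hsh := pinnedChain_act_resolvent_eq hω hl hβ hγ hN hT hϑ0 h2ϑ hv hCv hvb hs hh' z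
    have hcoe : ((hh' : ℝ≥0) : ℝ) = h := rfl
    simp only [hcoe] at hsh
    have hz1' : W z = 0 := hz1
    have hz2' : ∫ y, W y ∂(κ hh' z) = 0 := hz2
    simp only [hW, hact] at hz1' hz2'
    rw [hz2', hz1'] at hsh
    rw [← intervalIntegral.integral_of_le hh.le]
    have hepos : Real.exp (s * h) ≠ 0 := (Real.exp_pos _).ne'
    show ∫ t in (0 : ℝ)..h, Real.exp (-(s * t)) * act t z = 0
    have := hsh.symm
    rw [zero_sub, mul_neg, neg_eq_zero, mul_eq_zero] at this
    rcases this with h1 | h1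
    · exact absurd h1 hepos
    · exact h1
  -- the continuous function `ψ(t) = ⟨v, P_t v⟩` has vanishing weighted primitives
  set ψ : ℝ → ℝ := fun t => ∫ z, v z * act t z ∂μ with hψ
  have hv2 : Integrable (fun z => v z ^ 2) μ := (pinnedChain_integral_sq_act_le hω hl hβ hγ hN hT hϑ0 h2ϑ hv hvb 0).1
  have hψc : Continuous ψ :=
    pinnedChain_continuous_corr_of_sq_integrable hω hl hβ hγ hN hT hϑ0 h2ϑ hv.stronglyMeasurable hv2 hv hvb
  have hE2 : Integrable (fun y => Real.exp (2 * ϑ * P.hamiltonian N y)) μ :=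
    pinnedChain_integrable_exp_mul_hamiltonian_gibbsMeasure hω hl hβ.le γ N hT h2ϑ
  have hprim0 : ∀ h : ℝ, 0 < h → ∫ t in (0 : ℝ)..h, Real.exp (-(s * t)) * ψ t = 0 := by
    intro h hh
    have hexp : IntegrableOn (fun t : ℝ => Real.exp (-(s * t))) (Ioc 0 h) :=
      (Real.continuous_exp.comp (continuous_const.mul continuous_id).neg).integrableOn_Icc.mono_set Ioc_subset_Icc_self
    have hF := pinnedChain_integral_mul_setIntegral_exp_act hω hl hβ hγ hϑ0 hb hc hv hCv hvb μ hE2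
      hv.stronglyMeasurable hv2 hexp
    rw [intervalIntegral.integral_of_le hh.le, ← hF]
    have : (fun z => v z * ∫ t in Ioc 0 h, Real.exp (-(s * t)) * act t z) =ᵐ[μ] 0 := by
      filter_upwards [hV0 h hh] with z hz
      rw [hz]; simp
    rw [integral_congr_ae this]
    simp
  -- differentiate: `e^{-sh} ψ(h) = 0` for `h > 0`
  set I : ℝ → ℝ := fun h => ∫ t in (0 : ℝ)..h, Real.exp (-(s * t)) * ψ t with hI
  have hgc : Continuous fun t => Real.exp (-(s * t)) * ψ t :=
    (Real.continuous_exp.comp (continuous_const.mul continuous_id).neg).mul hψc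
  have hψ0 : ∀ h : ℝ, 0 < h → ψ h = 0 := by
    intro h hh
    have hIder : HasDerivAt I (Real.exp (-(s * h)) * ψ h) h :=
      intervalIntegral.integral_hasDerivAt_right (hgc.intervalIntegrable 0 h) (hgc.stronglyMeasurableAtFilter _ _)
        hgc.continuousAt
    have hI0 : I =ᶠ[𝓝 h] fun _ => (0 : ℝ) := by
      filter_upwards [Ioi_mem_nhds hh] with u hu
      exact hprim0 u hu
    have hder0 : HasDerivAt I 0 h := (hasDerivAt_const h (0 : ℝ)).congr_of_eventuallyEq hI0
    have huniq := hIder.unique hder0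
    rcases mul_eq_zero.1 huniq with h1 | h1
    · exact absurd h1 (Real.exp_pos _).ne'
    · exact h1
  -- continuity at `0⁺`: `ψ(0) = ∫ v² dμ_T = 0`
  have hlim1 : Tendsto ψ (𝓝[>] 0) (𝓝 (ψ 0)) := hψc.continuousAt.tendsto.mono_left nhdsWithin_le_nhds
  have hlim2 : Tendsto ψ (𝓝[>] 0) (𝓝 0) :=
    tendsto_const_nhds.congr' (eventually_nhdsWithin_of_forall fun h hh => (hψ0 h hh).symm)
  have hψ00 : ψ 0 = 0 := tendsto_nhds_unique hlim1 hlim2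
  have : ψ 0 = ∫ z, v z ^ 2 ∂μ := by
    simp only [hψ]
    refine integral_congr_ae (Eventually.of_forall fun z => ?_)
    show v z * act 0 z = v z ^ 2
    have hz : act 0 z = v z := pinnedChain_act_zero hω hl hβ hγ v z
    rw [hz, sq]
  rw [← this, hψ00]

end PinnedB

end Summit.AtomisticToContinuum.FouriersLaw.Theorems.HonestZwanzig

end
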